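import Summits.Ventures.PercRepro.SixFourResidueThreeOnePointB
import Summits.Ventures.PercRepro.SixFourResidueThreeSmall

/-!
# The `t = 3` clause of `SixFourResidue` — plane + one point at `P = 8`, part C: profile inequality and assembly (p2, gen 9)

The `p ≤ 8` small count (`SmallProf8`: triples, rank-`3` `4`-sets and rank-`3` `5`-sets; `card_small_le_SmallProf8` via
part B's `Tcnt_eq8` / `card_four_eq8` / `card_five_eq8`), the profile inequality `12·Small ≤ 6·T + 15·D₃ − 5·LP` decided on
the `95` admissible pairwise-OK profiles with `p ≤ 8` (`profCheck3'_holds`; minimum slack `6` at `p = 3`, `143` at `p = 8`),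
the demand-free long-line case (`J_three_nonneg_of_plane_add_one_of_line`: a `7`-point line in an `8`-point trace) and the
assembly `J_three_nonneg_of_plane_add_one' : (P₀ ∩ G).card + 1 = G.card → G.card ≤ 9 → 0 ≤ J M G 3` (Proposition 21.5 at
`t = 3` for `P ≤ 8`).
-/

namespace PercRepro.SixFour

/-! ## The profile side at `p ≤ 8` -/

/-- `#{B″ ∈ R₃(τ) : |B″| ≤ p − 3}` for `p ≤ 8`: the triples when `p ≥ 6`, the rank-`3` `4`-sets when `p ≥ 7` and the
rank-`3` `5`-sets when `p ≥ 8`. -/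
def SmallProf8 (p i3 i4 i5 i6 : ℕ) : ℤ :=
  (if 6 ≤ p then TProf p i3 i4 i5 i6 else 0) + (if 7 ≤ p then (r34Prof p i4 i5 i6 : ℤ) else 0) +
    (if 8 ≤ p then ((p.choose 5 - (i5 * 1 + i6 * 6) : ℕ) : ℤ) else 0)

/-- The profile inequality of Proposition 21.5 at `t = 3` (scaled by `10`) with the `p ≤ 8` small count. -/
def ProfIneq3' (p i3 i4 i5 i6 : ℕ) : Prop :=
  12 * SmallProf8 p i3 i4 i5 i6 ≤ 6 * TProf p i3 i4 i5 i6 + 15 * (D3Prof p i4 i5 i6 : ℤ) - 5 * LPProf p i3 i4 i5 i6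

/-- `ProfIneq3'` is decidable. -/
instance (p i3 i4 i5 i6 : ℕ) : Decidable (ProfIneq3' p i3 i4 i5 i6) := by unfold ProfIneq3'; infer_instance

/-- The finite check: every admissible, pairwise-OK profile with `p ≤ 8` satisfies the `t = 3` inequality. -/
def profCheck3' : Prop := ∀ p < 9, ∀ i3 < 10, ∀ i4 < 5, ∀ i5 < 3, ∀ i6 < 2,
  (!decide (ProfileOK p (p.choose 2 - (3 * i3 + 6 * i4 + 10 * i5 + 15 * i6)) i3 i4 i5 i6 ∧ PairOK p i3 i4 i5 i6) ||
    decide (ProfIneq3' p i3 i4 i5 i6)) = true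

/-- The finite check holds (`95` profiles; minimum slack `6` at `p = 3`, `143` at `p = 8`). -/
theorem profCheck3'_holds : profCheck3' := by
  unfold profCheck3'
  decide

/-- **The `t = 3` profile inequality** for every admissible, pairwise-OK profile with `p ≤ 8`. -/
theorem profIneq3'_of_profileOK {p i2 i3 i4 i5 i6 : ℕ} (hp : p ≤ 8) (h3 : i3 < 10) (h4 : i4 < 5) (h5 : i5 < 3)
    (h6 : i6 < 2) (hok : ProfileOK p i2 i3 i4 i5 i6) (hpair : PairOK p i3 i4 i5 i6) : ProfIneq3' p i3 i4 i5 i6 := by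
  have hi2 : i2 = p.choose 2 - (3 * i3 + 6 * i4 + 10 * i5 + 15 * i6) := by
    have := hok.1
    omega
  subst hi2
  have h := profCheck3'_holds p (by omega) i3 h3 i4 h4 i5 h5 i6 h6
  rw [Bool.or_eq_true, Bool.not_eq_true', decide_eq_false_iff_not, decide_eq_true_eq] at h
  exact h.resolve_left (not_not.2 ⟨hok, hpair⟩)

open Finset ThmH
variable {α : Type*} [DecidableEq α] {M : Matroid α} [M.Finite] {G : Finset α}

section Counts

variable (hs : Simple M) {τ : Finset α} (hτ : τ ⊆ gr M)
include hs hτ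

/-- **The demanded sets are small, `p ≤ 8`**: `#{S ∈ R₃(τ) : |S| + 3 ≤ p} ≤ SmallProf8` for a rank-`3` trace with `p ≤ 8`
and no `7`-point line. -/
theorem card_small_le_SmallProf8 (hr3 : M.eRk (τ : Set α) = 3) (h8 : τ.card ≤ 8) (hi7 : inc M τ 7 = 0) :
    ((((R3 M τ).filter (fun S => S.card + 3 ≤ τ.card)).card : ℕ) : ℤ) ≤
      SmallProf8 τ.card (inc M τ 3) (inc M τ 4) (inc M τ 5) (inc M τ 6) := by
  unfold SmallProf8
  rw [← Tcnt_eq8 hs hτ hr3 h8 hi7, ← card_four_eq8 hs hτ hr3 h8 hi7, ← card_five_eq8 hs hτ hr3 h8 hi7]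
  have hsub : (R3 M τ).filter (fun S => S.card + 3 ≤ τ.card) ⊆
      ((R3 M τ).filter (fun S => S.card = 3 ∧ 6 ≤ τ.card)) ∪ ((R3 M τ).filter (fun S => S.card = 4 ∧ 7 ≤ τ.card)) ∪
        ((R3 M τ).filter (fun S => S.card = 5 ∧ 8 ≤ τ.card)) := by
    intro S hS
    rw [Finset.mem_filter] at hS
    rw [Finset.mem_union, Finset.mem_union, Finset.mem_filter, Finset.mem_filter, Finset.mem_filter]
    have h3 : 3 ≤ S.card := three_le_card_of_eRk_eq_three (mem_R3.1 hS.1).2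
    rcases (show S.card = 3 ∨ S.card = 4 ∨ S.card = 5 by omega) with h | h | h
    · exact Or.inl (Or.inl ⟨hS.1, h, by omega⟩)
    · exact Or.inl (Or.inr ⟨hS.1, h, by omega⟩)
    · exact Or.inr ⟨hS.1, h, by omega⟩
  have h1 : ((R3 M τ).filter (fun S => S.card = 3 ∧ 6 ≤ τ.card)).card = if 6 ≤ τ.card then Tcnt M τ else 0 := by
    split_ifs with h6
    · unfold Tcnt
      congr 1
      exact Finset.filter_congr (fun S _ => by simp [h6])
    · rw [Finset.card_eq_zero, Finset.filter_eq_empty_iff]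
      intro S _ h
      exact h6 h.2
  have h2 : ((R3 M τ).filter (fun S => S.card = 4 ∧ 7 ≤ τ.card)).card =
      if 7 ≤ τ.card then ((R3 M τ).filter (fun S => S.card = 4)).card else 0 := by
    split_ifs with h7'
    · congr 1
      exact Finset.filter_congr (fun S _ => by simp [h7'])
    · rw [Finset.card_eq_zero, Finset.filter_eq_empty_iff]
      intro S _ h
      exact h7' h.2
  have h3 : ((R3 M τ).filter (fun S => S.card = 5 ∧ 8 ≤ τ.card)).card =
      if 8 ≤ τ.card then ((R3 M τ).filter (fun S => S.card = 5)).card else 0 := by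
    split_ifs with h8'
    · congr 1
      exact Finset.filter_congr (fun S _ => by simp [h8'])
    · rw [Finset.card_eq_zero, Finset.filter_eq_empty_iff]
      intro S _ h
      exact h8' h.2
  have hle : ((R3 M τ).filter (fun S => S.card + 3 ≤ τ.card)).card ≤
      ((R3 M τ).filter (fun S => S.card = 3 ∧ 6 ≤ τ.card)).card +
        ((R3 M τ).filter (fun S => S.card = 4 ∧ 7 ≤ τ.card)).card +
        ((R3 M τ).filter (fun S => S.card = 5 ∧ 8 ≤ τ.card)).card :=
    (Finset.card_le_card hsub).trans ((Finset.card_union_le _ _).trans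
      (add_le_add_left (Finset.card_union_le _ _) _))
  rw [h1, h2, h3] at hle
  have hz := (Nat.cast_le (α := ℤ)).2 hle
  push_cast at hz
  split_ifs at hz ⊢ <;> linarith

end Counts

/-! ## The `g ≤ 9` piece -/

section Final

variable (hs : Simple M) (hG : G ⊆ gr M) {P₀ : Finset α} (hP₀ : P₀ ∈ planes M)
include hs hG hP₀

omit hs in
/-- **The long-line case**: if some line meets the plane trace `τ = P₀ ∩ G` in `|τ| − 1` points, then `G = τ ∪ {a}`
is demand-free at `t = 3` (every rank-`4` `B″ ∪ {a}` contains the point of `τ` off the line, so its rest is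
collinear). -/
theorem J_three_nonneg_of_plane_add_one_of_line (hcard : (P₀ ∩ G).card + 1 = G.card) {L : Finset α}
    (hL : L ∈ lines M) (hLc : (L ∩ (P₀ ∩ G)).card + 1 = (P₀ ∩ G).card) : 0 ≤ J M G 3 := by
  obtain ⟨a, ht⟩ := oneOff_of_card (M := M) hcard
  set τ := P₀ ∩ G with hτdef
  have hL' := mem_lines.1 hL
  have hcard1 : (τ \ L).card = 1 := by
    have := Finset.card_sdiff_add_card_inter τ L
    rw [Finset.inter_comm] at this
    omega
  obtain ⟨y, hy⟩ := Finset.card_eq_one.1 hcard1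
  apply J_three_nonneg_of_demandFree
  intro B hB
  rw [R4_eq_image₁ ht hG hP₀, Finset.mem_image] at hB
  obtain ⟨B'', hB'', rfl⟩ := hB
  obtain ⟨hBτ, hB3⟩ := mem_R3.1 hB''
  rw [sdiff_insert_eq₁ ht]
  -- `τ ∖ B″ ⊆ L`: otherwise `B″ ⊆ L` has rank `≤ 2`
  have hsub : τ \ B'' ⊆ L := by
    intro x hx
    by_contra hxL
    have hx' : x ∈ τ \ L := Finset.mem_sdiff.2 ⟨(Finset.mem_sdiff.1 hx).1, hxL⟩
    rw [hy, Finset.mem_singleton] at hx'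
    have hBL : B'' ⊆ L := by
      intro b hb
      by_contra hbL
      have hb' : b ∈ τ \ L := Finset.mem_sdiff.2 ⟨hBτ hb, hbL⟩
      rw [hy, Finset.mem_singleton] at hb'
      rw [hb', ← hx'] at hb
      exact (Finset.mem_sdiff.1 hx).2 hb
    have h := M.eRk_mono (Finset.coe_subset.2 hBL)
    rw [hB3, hL'.2.2] at h
    have h32 : (3 : ℕ) ≤ 2 := by exact_mod_cast h
    omega
  calc M.eRk ((τ \ B'' : Finset α) : Set α) ≤ M.eRk (L : Set α) := M.eRk_mono (Finset.coe_subset.2 hsub)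
    _ = 2 := hL'.2.2

/-- **Proposition 21.5 at `t = 3`, `g ≤ 9` (§21.18.3 (β), `k = 1`, `P ≤ 8`)**: if some plane trace has `g − 1` points,
`0 ≤ J₃(G)`. -/
theorem J_three_nonneg_of_plane_add_one' (hcard : (P₀ ∩ G).card + 1 = G.card) (hg : G.card ≤ 9) : 0 ≤ J M G 3 := by
  by_cases hg8 : G.card ≤ 8
  · exact J_three_nonneg_of_plane_add_one hs hG hP₀ hcard hg8
  obtain ⟨a, ht⟩ := oneOff_of_card (M := M) hcard
  have hτ : P₀ ∩ G ⊆ gr M := Finset.inter_subset_right.trans hG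
  have hshares := J_three_ge_shares ht hG hP₀
  by_cases hr3 : M.eRk ((P₀ ∩ G : Finset α) : Set α) = 3
  · set τ := P₀ ∩ G with hτdef
    have h8 : τ.card ≤ 8 := by omega
    by_cases hi7 : inc M τ 7 = 0
    · have hsum := share3_sum_ge hs hτ
      have hdem := dem3_sum_le (M := M) (τ := τ)
      have hsmall := card_small_le_SmallProf8 hs hτ hr3 h8 hi7
      obtain ⟨hb3, hb4, hb5, hb6⟩ := inc_bounds_of_trace8 hs hτ h8
      have hok := profileOK_of_trace8 hs hτ hr3 h8 hi7
      have hpair := pairOK_of_trace hs (τ := τ)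
      have hineq := profIneq3'_of_profileOK h8 hb3 hb4 hb5 hb6 hok hpair
      unfold ProfIneq3' at hineq
      have hT := Tcnt_eq8 hs hτ hr3 h8 hi7
      have hD : ((D3cnt M τ : ℕ) : ℤ) = (D3Prof τ.card (inc M τ 4) (inc M τ 5) (inc M τ 6) : ℤ) := by
        exact_mod_cast D3cnt_eq8 hs hτ hr3 h8 hi7
      have hLP := LPcnt_le8 hs hτ hr3 h8 hi7
      have hZ : 12 * ((((R3 M τ).filter (fun S => S.card + 3 ≤ τ.card)).card : ℕ) : ℤ) ≤
          6 * (Tcnt M τ : ℤ) + 15 * (D3cnt M τ : ℤ) - 5 * (LPcnt M τ : ℤ) := by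
        rw [hT, hD]
        linarith
      have hQ : (12 : ℚ) * (((R3 M τ).filter (fun S => S.card + 3 ≤ τ.card)).card : ℚ) ≤
          6 * (Tcnt M τ : ℚ) + 15 * (D3cnt M τ : ℚ) - 5 * (LPcnt M τ : ℚ) := by
        exact_mod_cast hZ
      linarith
    · -- a `7`-point line in an `8`-point trace
      obtain ⟨L, hL, hLc⟩ := exists_line_of_inc (M := M) (τ := τ) 7 (by omega)
      have hLc' : (L ∩ (P₀ ∩ G)).card + 1 = (P₀ ∩ G).card := by
        show (L ∩ τ).card + 1 = τ.card
        omega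
      exact J_three_nonneg_of_plane_add_one_of_line hG hP₀ hcard hL hLc'
  · have hempty : R3 M (P₀ ∩ G) = ∅ := by
      rw [Finset.eq_empty_iff_forall_notMem]
      intro S hS
      obtain ⟨hSτ, hS3⟩ := mem_R3.1 hS
      apply hr3
      refine le_antisymm ?_ (by rw [← hS3]; exact M.eRk_mono (Finset.coe_subset.2 hSτ))
      rw [← (mem_planes.1 hP₀).2.2]
      exact M.eRk_mono (Finset.coe_subset.2 Finset.inter_subset_left)
    rw [hempty, Finset.sum_empty, Finset.sum_empty] at hshares
    linarith

end Final

end PercRepro.SixFour
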